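import Literature.RingTheory.RegularLocalRing.RankOneEmbedding
import Literature.RingTheory.RegularLocalRing.SaturationPrincipal
import Literature.RingTheory.RegularLocalRing.AdicGeneration
import Literature.RingTheory.RegularLocalRing.GrothendieckSamuelHypersurfaceComplete
import Mathlib.RingTheory.UniqueFactorizationDomain.GCDMonoid
import Mathlib.Algebra.GCDMonoid.Finset
import HarnessLib

/-!
# The algebraisation endgame of Grothendieck's parafactoriality theorem for hypersurfaces

Topic `Literature/RingTheory/RegularLocalRing`. The last, purely commutative-algebraic step of
SGA 2 XI 3.13 (ii) in the hypersurface case (the complete case `hC` of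
`Grothendieck1968_samuelConjecture_hypersurface`), in abstract form. Data: a local Noetherian
factorial domain `S`, complete (precomplete for `𝔪`), a surjection `S ↠ B` with kernel `(g)`,
`g ∈ 𝔪`, an ideal `J ⊆ B` containing a non-zero-divisor, principal at the non-maximal primes and
`𝔪`-saturated, `B` of depth `≥ 2` with a non-maximal prime; and an `S`-module `N` (in the
application: the limit of the stable sections of the formal line bundle) with an `S`-linear
`θ : N → J` whose kernel is `gN`, whose cokernel on `J` is killed by `𝔪^C`, with `N`
`g`-adically separated, torsion-free and without `𝔪`-torsion modulo `g`. Conclusion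
(`isPrincipal_of_comparison`): `J` is principal. Steps, all proved here:

* `moduleFinite_of_comparison` — `N` is finite (`N/gN ≅ θ(N) ⊆ B` Noetherian, `AdicGeneration`);
* `exists_cyclic_at_prime` — at a non-maximal prime `P`, `N` is cyclic modulo `g` up to units
  outside `P` (from `J_P` principal); with Nakayama at a prime and torsion-freeness
  (`RankOneEmbedding`) `N ≅ 𝔞`, an ideal of `S`;
* `exists_eq_mul_ideal_coprime` — `𝔞 = d·𝔞'` with no prime dividing all of `𝔞'` (gcd in the UFD);
  then no non-maximal prime of `B` contains `𝔞'` (a prime factor of a local generator inside the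
  prime would divide all of `𝔞'`), so `I = 𝔞'B ⊇ 𝔪_B^{k'}`;
* the absence of `𝔪`-torsion modulo `g` identifies `ker θ` with `ker (N ≅ 𝔞' → B)`, whence a
  `B`-linear isomorphism `θ(N) ≅ I`, and `isPrincipal_of_linearEquiv_of_saturated`
  (`SaturationPrincipal`) gives the principality of `J`.

Everything is proved; no named facts.

## References

* [Grothendieck1968SGA2] A. Grothendieck, SGA 2, Exp. XI, Thm. 3.13 (ii), Prop. 3.5, Cor. 3.9;
  Exp. IX §2 (arXiv:math/0511279, pp. 58, 70–72).
* [Matsumura1987] H. Matsumura, *Commutative Ring Theory*, Thm. 2.2 (Nakayama), Thm. 8.10 (Krull).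
-/

noncomputable section

universe u v

namespace Literature.RingTheory.RegularLocalRing

open IsLocalRing

section Endgame

variable {S : Type u} [CommRing S] {B : Type u} [CommRing B] [Algebra S B]
variable (g : S) (hsurj : Function.Surjective (algebraMap S B))
variable {N : Type v} [AddCommGroup N] [Module S N] (θ : N →ₗ[S] B) (J : Ideal B)
  (hθJ : ∀ x, θ x ∈ J)

/-- The image `D = θ(N)`, an ideal of `B` (`θ` is `S`-linear and `S ↠ B`). [folklore] -/
def imageIdeal : Ideal B where
  carrier := {b | ∃ x, θ x = b}
  add_mem' := by
    rintro _ _ ⟨x, rfl⟩ ⟨x', rfl⟩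
    exact ⟨x + x', by rw [map_add]⟩
  zero_mem' := ⟨0, by rw [map_zero]⟩
  smul_mem' := by
    rintro b _ ⟨x, rfl⟩
    obtain ⟨r, rfl⟩ := hsurj b
    exact ⟨r • x, by rw [LinearMap.map_smul, Algebra.smul_def, smul_eq_mul]⟩

/-- Membership in `D`. [folklore] -/
theorem mem_imageIdeal_iff (b : B) : b ∈ imageIdeal hsurj θ ↔ ∃ x, θ x = b := Iff.rfl

include hθJ in
/-- `D ≤ J`. [folklore] -/
theorem imageIdeal_le : imageIdeal hsurj θ ≤ J := by
  rintro _ ⟨x, rfl⟩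
  exact hθJ x

/-- `𝔪_B^C · J ⊆ D` when the cokernel of `θ` on `J` is killed by `𝔪_S^C`. [folklore] -/
theorem pow_mul_le_imageIdeal [IsLocalRing S] [IsLocalRing B]
    (hmB : (maximalIdeal S).map (algebraMap S B) = maximalIdeal B) (C : ℕ)
    (hcok : ∀ r ∈ maximalIdeal S ^ C, ∀ j ∈ J, ∃ x, θ x = algebraMap S B r * j) :
    maximalIdeal B ^ C * J ≤ imageIdeal hsurj θ := by
  rw [← hmB, ← Ideal.map_pow]
  apply Ideal.mul_le.mpr
  intro z hz j hj
  rw [Ideal.mem_map_iff_of_surjective _ hsurj] at hz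
  obtain ⟨r, hr, rfl⟩ := hz
  exact hcok r hr j hj

include hsurj hθJ in
/-- **Cyclicity of `N` at the non-maximal primes of `V(g)`**, modulo `g`: for a non-maximal
prime `P` of `B` there is `ℓ₀ ∈ N` with `θ ℓ₀ ≠ 0` such that every `x ∈ N` satisfies
`u x = a ℓ₀ + g w` with `u ∉ P` (pulled back to `S`). Uses `J_P` principal (clearing
denominators) and the cokernel bound. [folklore] -/
theorem exists_cyclic_at_prime [IsLocalRing S] [IsLocalRing B] [IsNoetherianRing B]
    (hmB : (maximalIdeal S).map (algebraMap S B) = maximalIdeal B) (C : ℕ)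
    (hcok : ∀ r ∈ maximalIdeal S ^ C, ∀ j ∈ J, ∃ x, θ x = algebraMap S B r * j)
    (hker : ∀ x, θ x = 0 → ∃ x', x = g • x')
    (hreg : ∃ c ∈ J, c ∈ nonZeroDivisors B)
    (P : Ideal B) [P.IsPrime] (hP : ¬ P.IsMaximal)
    (hloc : (J.map (algebraMap B (Localization.AtPrime P))).IsPrincipal) :
    ∃ ℓ₀ : N, θ ℓ₀ ≠ 0 ∧ ∀ x : N, ∃ u ∉ P.comap (algebraMap S B), ∃ (a : S) (w : N),
      u • x = a • ℓ₀ + g • w := by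
  -- clearing denominators: `t J ⊆ (a₀)`, `a₀ ∈ J`, `t ∉ P`
  obtain ⟨a₀, ha₀J, t, htP, ht⟩ :=
    exists_mem_forall_mul_mem_span_of_isPrincipal_map' J (IsNoetherian.noetherian J) P hloc
  -- an element `x₀ ∈ 𝔪_S` whose image avoids `P`
  have hPm : ¬ maximalIdeal B ≤ P := fun h => hP (by
    have : P = maximalIdeal B :=
      le_antisymm (IsLocalRing.le_maximalIdeal (Ideal.IsPrime.ne_top inferInstance)) h
    rw [this]
    exact maximalIdeal.isMaximal B)
  obtain ⟨z, hzm, hzP⟩ := Set.not_subset.mp hPm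
  rw [← hmB, SetLike.mem_coe, Ideal.mem_map_iff_of_surjective _ hsurj] at hzm
  obtain ⟨x₀, hx₀m, rfl⟩ := hzm
  have hr₀ : x₀ ^ C ∈ maximalIdeal S ^ C := Ideal.pow_mem_pow hx₀m C
  have hr₀P : algebraMap S B (x₀ ^ C) ∉ P := by
    rw [map_pow]
    exact fun h => hzP (Ideal.IsPrime.mem_of_pow_mem inferInstance C h)
  -- `ℓ₀` with `θ ℓ₀ = x₀^C · t · a₀`
  obtain ⟨ℓ₀, hℓ₀⟩ := hcok _ hr₀ (t * a₀) (J.mul_mem_left t ha₀J)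
  -- annihilators of `a₀` lie in `P` (`J_P = (a₀) ∋ c` regular)
  obtain ⟨c, hcJ, hc⟩ := hreg
  have hann : ∀ v : B, v * a₀ = 0 → v ∈ P := by
    intro v hv
    obtain ⟨e, he⟩ := Ideal.mem_span_singleton'.mp (ht c hcJ)
    -- `t c = e a₀`, so `v t c = 0`, so `v t = 0 ∈ P`, so `v ∈ P`
    have h1 : (v * t) * c = 0 := by rw [mul_assoc, ← he, ← mul_assoc, mul_comm v e, mul_assoc, hv, mul_zero]
    have h2 : v * t = 0 := (mul_right_mem_nonZeroDivisors_eq_zero_iff hc).mp h1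
    have h3 : v * t ∈ P := by rw [h2]; exact P.zero_mem
    exact ((inferInstance : P.IsPrime).mem_or_mem h3).resolve_right htP
  refine ⟨ℓ₀, ?_, ?_⟩
  · rw [hℓ₀, ← mul_assoc]
    intro h0
    have := hann _ h0
    exact ((inferInstance : P.IsPrime).mem_or_mem this).elim hr₀P htP
  · intro x
    obtain ⟨e, he⟩ := Ideal.mem_span_singleton'.mp (ht (θ x) (hθJ x))
    obtain ⟨t', rfl⟩ := hsurj t
    obtain ⟨e', rfl⟩ := hsurj e
    -- `u := x₀^C t'^2`, `a := e'`
    have hk : θ ((x₀ ^ C * t' * t') • x - e' • ℓ₀) = 0 := by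
      rw [map_sub, LinearMap.map_smul, LinearMap.map_smul, hℓ₀, Algebra.smul_def, Algebra.smul_def,
        map_mul, map_mul, mul_assoc (algebraMap S B (x₀ ^ C) * algebraMap S B t'), ← he]
      ring
    obtain ⟨w, hw⟩ := hker _ hk
    refine ⟨x₀ ^ C * t' * t', ?_, e', w, ?_⟩
    · rw [Ideal.mem_comap, map_mul, map_mul]
      intro h
      rcases (inferInstance : P.IsPrime).mem_or_mem h with h | h
      · rcases (inferInstance : P.IsPrime).mem_or_mem h with h | h
        · exact hr₀P h
        · exact htP h
      · exact htP h
    · rw [← hw, add_sub_cancel]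

include hsurj in
/-- **`N` is finitely generated**: `N/gN ≅ D ⊆ B` is Noetherian, `N` is `g`-adically separated and
`S` is complete (`AdicGeneration`). [cite: Grothendieck1968SGA2, Exp. IX §2] -/
theorem moduleFinite_of_comparison [IsLocalRing S] [IsNoetherianRing S] [IsNoetherianRing B]
    [IsPrecomplete (maximalIdeal S) S] (hgm : g ∈ maximalIdeal S)
    (hker : ∀ x, θ x = 0 → ∃ x', x = g • x')
    (hsep : ∀ x : N, (∀ k : ℕ, ∃ x', x = g ^ k • x') → x = 0) : Module.Finite S N := by
  classical
  -- generators of `D` over `B`, lifted to `N`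
  obtain ⟨r, d, hd⟩ := Submodule.fg_iff_exists_fin_generating_family.mp
    (IsNoetherian.noetherian (imageIdeal hsurj θ))
  have hdmem : ∀ i, d i ∈ imageIdeal hsurj θ := fun i => by
    rw [← hd]; exact Submodule.subset_span ⟨i, rfl⟩
  choose m hm using fun i => (mem_imageIdeal_iff hsurj θ (d i)).mp (hdmem i)
  have hgen : ∀ x : N, ∃ (c : Fin r → S) (x' : N), x = ∑ i, c i • m i + g • x' := by
    intro x
    have hx : θ x ∈ Submodule.span B (Set.range d) := by rw [hd]; exact ⟨x, rfl⟩
    obtain ⟨b, hb⟩ := (Submodule.mem_span_range_iff_exists_fun B).mp hx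
    choose c hc using fun i => hsurj (b i)
    have hk : θ (x - ∑ i, c i • m i) = 0 := by
      rw [map_sub, map_sum, sub_eq_zero, ← hb]
      refine Finset.sum_congr rfl fun i _ => ?_
      rw [LinearMap.map_smul, hm, smul_eq_mul, Algebra.smul_def, hc]
    obtain ⟨x', hx'⟩ := hker _ hk
    exact ⟨c, x', by rw [← hx', add_sub_cancel]⟩
  have key := exists_eq_sum_smul_of_forall_add_smul (maximalIdeal S)
    (IsLocalRing.maximalIdeal_le_jacobson ⊥) hgm hsep m hgen
  refine ⟨(Submodule.fg_iff_exists_fin_generating_family).mpr ⟨r, m, ?_⟩⟩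
  rw [Submodule.eq_top_iff']
  intro x
  obtain ⟨a, rfl⟩ := key x
  exact Submodule.sum_mem _ fun i _ => Submodule.smul_mem _ _ (Submodule.subset_span ⟨i, rfl⟩)

omit [Algebra S B] in
/-- In a factorial domain, a nonzero element of a prime ideal has a prime factor in it.
[folklore] -/
theorem exists_prime_dvd_mem [IsDomain S] [UniqueFactorizationMonoid S] (Q : Ideal S) [Q.IsPrime]
    {z : S} (hzQ : z ∈ Q) (hz0 : z ≠ 0) : ∃ π : S, Prime π ∧ π ∣ z ∧ π ∈ Q := by
  induction z using UniqueFactorizationMonoid.induction_on_prime with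
  | h₁ => exact absurd rfl hz0
  | h₂ x hx => exact absurd (Ideal.eq_top_of_isUnit_mem Q hzQ hx) (Ideal.IsPrime.ne_top inferInstance)
  | h₃ a p ha0 hp ih =>
    rcases (inferInstance : Q.IsPrime).mem_or_mem hzQ with h | h
    · exact ⟨p, hp, dvd_mul_right p a, h⟩
    · obtain ⟨π, hπ, hπa, hπQ⟩ := ih h ha0
      exact ⟨π, hπ, dvd_mul_of_dvd_right hπa p, hπQ⟩

omit [Algebra S B] in
/-- **Extracting the greatest common divisor of an ideal** of a Noetherian factorial domain:
`𝔞 = d · 𝔞'` with no prime dividing all of `𝔞'`. [folklore] -/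
theorem exists_eq_mul_ideal_coprime [IsDomain S] [IsNoetherianRing S] [UniqueFactorizationMonoid S]
    (𝔞 : Ideal S) (h𝔞 : 𝔞 ≠ ⊥) :
    ∃ (d : S) (𝔞' : Ideal S), d ≠ 0 ∧ (∀ z ∈ 𝔞', d * z ∈ 𝔞) ∧ (∀ w ∈ 𝔞, ∃ z ∈ 𝔞', w = d * z) ∧
      ∀ π : S, Prime π → (∀ z ∈ 𝔞', π ∣ z) → False := by
  classical
  letI : NormalizationMonoid S :=
    (UniqueFactorizationMonoid.strongNormalizationMonoid (α := S)).toNormalizationMonoid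
  letI : NormalizedGCDMonoid S := UniqueFactorizationMonoid.toNormalizedGCDMonoid S
  obtain ⟨G, hG⟩ := IsNoetherian.noetherian 𝔞
  have hGne : G.Nonempty := by
    rw [Finset.nonempty_iff_ne_empty]
    rintro rfl
    rw [Finset.coe_empty, Submodule.span_empty] at hG
    exact h𝔞 hG.symm
  obtain ⟨q, hq, hgcd⟩ := Finset.extract_gcd (id : S → S) hGne
  set d := G.gcd id with hddef
  have hd0 : d ≠ 0 := by
    intro h0
    rw [hddef, Finset.gcd_eq_zero_iff] at h0
    apply h𝔞
    rw [← hG, Submodule.span_eq_bot]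
    intro x hx
    exact h0 x hx
  refine ⟨d, Ideal.span (q '' (G : Set S)), hd0, ?_, ?_, ?_⟩
  · intro z hz
    refine Submodule.span_induction ?_ ?_ ?_ ?_ hz
    · rintro _ ⟨b, hb, rfl⟩
      rw [← hq b hb, id]
      rw [← hG]
      exact Submodule.subset_span hb
    · rw [mul_zero]; exact 𝔞.zero_mem
    · intro x y _ _ hx hy
      rw [mul_add]; exact 𝔞.add_mem hx hy
    · intro a x _ hx
      rw [smul_eq_mul, mul_left_comm]; exact 𝔞.mul_mem_left a hx
  · intro w hw
    rw [← hG, Submodule.mem_span_finset] at hw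
    obtain ⟨f, -, rfl⟩ := hw
    refine ⟨∑ b ∈ G, f b * q b, ?_, ?_⟩
    · exact Ideal.sum_mem _ fun b hb => Ideal.mul_mem_left _ _ (Ideal.subset_span ⟨b, hb, rfl⟩)
    · rw [Finset.mul_sum]
      refine Finset.sum_congr rfl fun b hb => ?_
      rw [smul_eq_mul, mul_left_comm, ← hq b hb, id]
  · intro π hπ hdiv
    have h1 : π ∣ G.gcd q := Finset.dvd_gcd fun b hb => hdiv _ (Ideal.subset_span ⟨b, hb, rfl⟩)
    rw [hgcd] at h1
    exact hπ.not_unit (isUnit_of_dvd_one h1)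

include hsurj hθJ in
/-- **The algebraisation endgame** (SGA 2 XI 3.13 (ii), hypersurface case, last step): with the
module of formal sections `N`, its comparison map `θ : N → J` (kernel `gN`, cokernel on `J`
killed by `𝔪^C`), `g`-adic separatedness, torsion-freeness and the absence of `𝔪`-torsion
modulo `g`, over a complete local factorial `S ↠ B = S/(g)`, the `𝔪`-saturated ideal `J`
(containing a non-zero-divisor, principal at the non-maximal primes) of the local ring `B` of
depth `≥ 2` is principal. Proof: `N` is finite (`moduleFinite_of_comparison`), torsion-free and
cyclic at the non-maximal primes of `V(g)` (`exists_cyclic_at_prime` + Nakayama), hence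
isomorphic to an ideal `𝔞 = d 𝔞'` of `S` with `𝔞'` coprime (`exists_eq_mul_ideal_coprime`); no
non-maximal prime of `B` contains `𝔞'` (a prime factor of the local generator would divide all
of `𝔞'`), so `I = 𝔞' B ⊇ 𝔪_B^{k'}`; the absence of `𝔪`-torsion gives `D = θ(N) ≅ N/gN ≅ 𝔞'/g𝔞' ≅ I`,
and `isPrincipal_of_linearEquiv_of_saturated` concludes.
[cite: Grothendieck1968SGA2, Exp. XI Thm. 3.13 (ii), Prop. 3.5, Cor. 3.9; Exp. IX §2] -/
theorem isPrincipal_of_comparison [IsLocalRing S] [IsNoetherianRing S] [IsDomain S]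
    [UniqueFactorizationMonoid S] [IsPrecomplete (maximalIdeal S) S]
    [IsLocalRing B] [IsNoetherianRing B]
    (hkerB : ∀ x : S, algebraMap S B x = 0 ↔ x ∈ Ideal.span {g})
    (hmB : (maximalIdeal S).map (algebraMap S B) = maximalIdeal B) (hgm : g ∈ maximalIdeal S)
    (C : ℕ) (hcok : ∀ r ∈ maximalIdeal S ^ C, ∀ j ∈ J, ∃ x, θ x = algebraMap S B r * j)
    (hker : ∀ x, θ x = 0 → ∃ x', x = g • x')
    (hsep : ∀ x : N, (∀ k : ℕ, ∃ x', x = g ^ k • x') → x = 0)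
    (htf : ∀ a : S, a ≠ 0 → ∀ x : N, a • x = 0 → x = 0)
    (hnt : ∀ (x : N) (k : ℕ), (∀ r ∈ maximalIdeal S ^ k, ∃ x', r • x = g • x') → ∃ x', x = g • x')
    (hreg : ∃ c ∈ J, c ∈ nonZeroDivisors B)
    (hloc : ∀ (P : Ideal B) [P.IsPrime], ¬ P.IsMaximal →
      (J.map (algebraMap B (Localization.AtPrime P))).IsPrincipal)
    (hJsat : ∀ b : B, (∀ x ∈ maximalIdeal B, x * b ∈ J) → b ∈ J)
    {rs : List B} (hrs : RingTheory.Sequence.IsRegular B rs) (hmem : ∀ r ∈ rs, r ∈ maximalIdeal B)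
    (hlen : 2 ≤ rs.length) (hQ : ∃ Q : Ideal B, Q.IsPrime ∧ ¬ Q.IsMaximal) : J.IsPrincipal := by
  classical
  haveI : Module.Finite S N := moduleFinite_of_comparison g hsurj θ hgm hker hsep
  haveI : NoZeroSMulDivisors S N := ⟨fun {a x} h => by
    by_cases ha : a = 0
    · exact Or.inl ha
    · exact Or.inr (htf a ha x h)⟩
  have hgB : algebraMap S B g = 0 := (hkerB g).mpr (Ideal.mem_span_singleton_self g)
  have hθg : ∀ x', θ (g • x') = 0 := fun x' => by
    rw [LinearMap.map_smul, Algebra.smul_def, hgB, zero_mul]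
  -- cyclicity at the non-maximal primes (Nakayama)
  have cyc : ∀ (P : Ideal B) [P.IsPrime], ¬ P.IsMaximal → ∃ ℓ : N, θ ℓ ≠ 0 ∧
      ∀ x : N, ∃ u ∉ P.comap (algebraMap S B), ∃ a : S, u • x = a • ℓ := by
    intro P _ hP
    obtain ⟨ℓ, hℓ, hrel⟩ := exists_cyclic_at_prime g hsurj θ J hθJ hmB C hcok hker hreg P hP (hloc P hP)
    refine ⟨ℓ, hℓ, ?_⟩
    haveI : (P.comap (algebraMap S B)).IsPrime := Ideal.IsPrime.comap _
    have hgQ : g ∈ P.comap (algebraMap S B) := by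
      rw [Ideal.mem_comap, hgB]
      exact P.zero_mem
    exact exists_smul_eq_smul_of_forall_add (P.comap (algebraMap S B)) hgQ ℓ hrel
  -- `N` is isomorphic to an ideal `𝔞` of `S`
  obtain ⟨Q₀, hQ₀p, hQ₀m⟩ := hQ
  haveI := hQ₀p
  obtain ⟨ℓ₀, hℓ₀, hcyc₀⟩ := cyc Q₀ hQ₀m
  have hℓ₀0 : ℓ₀ ≠ 0 := fun h => hℓ₀ (by rw [h, map_zero])
  haveI : (Q₀.comap (algebraMap S B)).IsPrime := Ideal.IsPrime.comap _
  obtain ⟨𝔞, ⟨e𝔞⟩⟩ :=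
    exists_ideal_linearEquiv_of_forall_smul_eq_smul (Q₀.comap (algebraMap S B)) hℓ₀0 hcyc₀
  have h𝔞0 : 𝔞 ≠ ⊥ := by
    intro h
    apply hℓ₀0
    apply e𝔞.injective
    apply Subtype.ext
    have h1 : ((e𝔞 ℓ₀ : 𝔞) : S) = 0 := (Submodule.eq_bot_iff 𝔞).mp h _ (e𝔞 ℓ₀).2
    rw [h1, map_zero, Submodule.coe_zero]
  -- extract the gcd: `𝔞 = d 𝔞'`, and the injective `χ : N → S` onto `𝔞'`
  obtain ⟨d, 𝔞', hd0, h1, h2, h3⟩ := exists_eq_mul_ideal_coprime 𝔞 h𝔞0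
  have hex : ∀ x : N, ∃ z ∈ 𝔞', ((e𝔞 x : 𝔞) : S) = d * z := fun x => h2 _ (e𝔞 x).2
  choose χf hχmem hχf using hex
  have huniq : ∀ (x : N) (z : S), ((e𝔞 x : 𝔞) : S) = d * z → z = χf x := fun x z hz =>
    mul_left_cancel₀ hd0 (hz.symm.trans (hχf x))
  let χ : N →ₗ[S] S :=
    { toFun := χf
      map_add' := fun x x' => (huniq _ _ (by
        rw [map_add, Submodule.coe_add, hχf, hχf, mul_add])).symm
      map_smul' := fun r x => (huniq _ _ (by
        rw [LinearEquiv.map_smul, Submodule.coe_smul, hχf, RingHom.id_apply, smul_eq_mul,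
          smul_eq_mul, mul_left_comm])).symm }
  have hχapply : ∀ x, χ x = χf x := fun x => rfl
  have hχinj : Function.Injective χ := by
    intro x x' h
    apply e𝔞.injective
    apply Subtype.ext
    rw [hχf, hχf, ← hχapply, ← hχapply, h]
  have hχsurj : ∀ z ∈ 𝔞', ∃ x, χ x = z := by
    intro z hz
    refine ⟨e𝔞.symm ⟨d * z, h1 z hz⟩, ?_⟩
    rw [hχapply]
    exact (huniq _ _ (by rw [LinearEquiv.apply_symm_apply])).symm
  have hχmem' : ∀ x, χ x ∈ 𝔞' := fun x => hχmem x
  -- E3: no non-maximal prime of `B` contains `𝔞'`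
  have hE3 : ∀ (P : Ideal B) [P.IsPrime], ¬ P.IsMaximal → ¬ (𝔞' ≤ P.comap (algebraMap S B)) := by
    intro P _ hP hle
    obtain ⟨ℓ, hℓ, hcycP⟩ := cyc P hP
    haveI : (P.comap (algebraMap S B)).IsPrime := Ideal.IsPrime.comap _
    have hz0 : χ ℓ ≠ 0 := fun h => hℓ (by
      have : ℓ = 0 := hχinj (by rw [h, map_zero])
      rw [this, map_zero])
    obtain ⟨π, hπ, hπz, hπQ⟩ := exists_prime_dvd_mem (P.comap (algebraMap S B)) (hle (hχmem' ℓ)) hz0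
    refine h3 π hπ fun z hz => ?_
    obtain ⟨x, rfl⟩ := hχsurj z hz
    obtain ⟨u, huQ, a, hux⟩ := hcycP x
    have hrel : u * χ x = a * χ ℓ := by
      have := congrArg χ hux
      rw [LinearMap.map_smul, LinearMap.map_smul, smul_eq_mul, smul_eq_mul] at this
      exact this
    have hdvd : π ∣ u * χ x := by rw [hrel]; exact dvd_mul_of_dvd_right hπz a
    rcases hπ.dvd_or_dvd hdvd with h | h
    · obtain ⟨k, rfl⟩ := h
      exact absurd ((P.comap (algebraMap S B)).mul_mem_right k hπQ) huQ
    · exact h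
  -- hence `𝔪_B^{k'} ≤ I := 𝔞' B`
  set I : Ideal B := 𝔞'.map (algebraMap S B) with hI
  obtain ⟨k', hk'⟩ : ∃ k' : ℕ, maximalIdeal B ^ k' ≤ I := by
    have hrad : maximalIdeal B ≤ I.radical := by
      rw [Ideal.radical_eq_sInf]
      refine le_sInf fun P hP => ?_
      obtain ⟨hIP, hPp⟩ := hP
      haveI : P.IsPrime := hPp
      by_cases hPm : P.IsMaximal
      · rw [IsLocalRing.eq_maximalIdeal hPm]
      · exact absurd (Ideal.map_le_iff_le_comap.mp hIP) (hE3 P hPm)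
    exact Ideal.exists_pow_le_of_le_radical_of_fg hrad (IsNoetherian.noetherian _)
  -- `F : N → B`, `x ↦ χ x mod g`, has the same kernel as `θ` (no `𝔪`-torsion modulo `g`)
  let F : N →ₗ[S] B := (Algebra.linearMap S B) ∘ₗ χ
  have hFapply : ∀ x, F x = algebraMap S B (χ x) := fun x => rfl
  have hkerF : ∀ x, F x = 0 → θ x = 0 := by
    intro x hx
    rw [hFapply, hkerB] at hx
    obtain ⟨s₁, hs₁⟩ := Ideal.mem_span_singleton'.mp hx
    have hmx : ∀ r ∈ maximalIdeal S ^ k', ∃ x', r • x = g • x' := by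
      intro r hr
      have hrB : algebraMap S B r ∈ I :=
        hk' (by rw [← hmB, ← Ideal.map_pow]; exact Ideal.mem_map_of_mem _ hr)
      rw [hI, Ideal.mem_map_iff_of_surjective _ hsurj] at hrB
      obtain ⟨q, hq, hqr⟩ := hrB
      have hrq : r - q ∈ Ideal.span {g} := by rw [← hkerB, map_sub, hqr, sub_self]
      obtain ⟨s₂, hs₂⟩ := Ideal.mem_span_singleton'.mp hrq
      have hrs₁ : r * s₁ ∈ 𝔞' := by
        have : r * s₁ = q * s₁ + s₂ * (s₁ * g) := by linear_combination (-s₁) * hs₂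
        rw [this]
        refine 𝔞'.add_mem (𝔞'.mul_mem_right s₁ hq) (𝔞'.mul_mem_left s₂ ?_)
        rw [hs₁]
        exact hχmem' x
      obtain ⟨x'', hx''⟩ := hχsurj _ hrs₁
      refine ⟨x'', hχinj ?_⟩
      rw [LinearMap.map_smul, LinearMap.map_smul, hx'', smul_eq_mul, smul_eq_mul, ← hs₁]
      ring
    obtain ⟨x', rfl⟩ := hnt x k' hmx
    exact hθg x'
  have hkerθ : ∀ x, θ x = 0 → F x = 0 := by
    intro x hx
    obtain ⟨x', rfl⟩ := hker x hx
    rw [hFapply, LinearMap.map_smul, smul_eq_mul, map_mul, hgB, zero_mul]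
  have hrangeF : ∀ b, b ∈ I ↔ ∃ x, F x = b := by
    intro b
    rw [hI, Ideal.mem_map_iff_of_surjective _ hsurj]
    constructor
    · rintro ⟨q, hq, rfl⟩
      obtain ⟨x, hx⟩ := hχsurj q hq
      exact ⟨x, by rw [hFapply, hx]⟩
    · rintro ⟨x, rfl⟩
      exact ⟨χ x, hχmem' x, rfl⟩
  have hwd : ∀ x x', θ x = θ x' → F x = F x' := fun x x' h => by
    have := hkerθ (x - x') (by rw [map_sub, h, sub_self])
    rwa [map_sub, sub_eq_zero] at this
  have hwd' : ∀ x x', F x = F x' → θ x = θ x' := fun x x' h => by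
    have := hkerF (x - x') (by rw [map_sub, h, sub_self])
    rwa [map_sub, sub_eq_zero] at this
  -- the `B`-linear isomorphism `D ≃ I`
  have hpre : ∀ dd : imageIdeal hsurj θ, ∃ x, θ x = dd := fun dd => dd.2
  choose pre hpre using hpre
  have hpreI : ∀ ii : I, ∃ x, F x = ii := fun ii => (hrangeF ii).mp ii.2
  choose preI hpreI using hpreI
  let e : imageIdeal hsurj θ ≃ₗ[B] I :=
    { toFun := fun dd => ⟨F (pre dd), (hrangeF _).mpr ⟨_, rfl⟩⟩
      invFun := fun ii => ⟨θ (preI ii), ⟨_, rfl⟩⟩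
      map_add' := fun dd dd' => by
        apply Subtype.ext
        change F (pre (dd + dd')) = F (pre dd) + F (pre dd')
        rw [← map_add]
        apply hwd
        rw [map_add, hpre, hpre, hpre]
        rfl
      map_smul' := fun b dd => by
        apply Subtype.ext
        obtain ⟨r, rfl⟩ := hsurj b
        change F (pre (algebraMap S B r • dd)) = algebraMap S B r * F (pre dd)
        have h1 : F (pre (algebraMap S B r • dd)) = F (r • pre dd) := by
          apply hwd
          rw [hpre, LinearMap.map_smul, hpre, Algebra.smul_def]
          rfl
        rw [h1, LinearMap.map_smul, Algebra.smul_def]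
      left_inv := fun dd => by
        apply Subtype.ext
        change θ (preI ⟨F (pre dd), _⟩) = (dd : B)
        rw [← hpre dd]
        apply hwd'
        rw [hpreI]
      right_inv := fun ii => by
        apply Subtype.ext
        change F (pre ⟨θ (preI ii), _⟩) = (ii : B)
        rw [← hpreI ii]
        apply hwd
        rw [hpre] }
  -- conclude
  have hx : ∃ x ∈ maximalIdeal B, x ∈ nonZeroDivisors B :=
    exists_mem_maximalIdeal_mem_nonZeroDivisors_of_isRegular hrs hmem (by omega)
  exact isPrincipal_of_linearEquiv_of_saturated hx
    (fun p hp b hb => mem_span_singleton_of_forall_mul_mem hrs hmem hlen hp b hb) J hJsat hreg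
    (imageIdeal hsurj θ) (imageIdeal_le hsurj θ J hθJ) C (pow_mul_le_imageIdeal hsurj θ J hmB C hcok)
    I k' hk' e

end Endgame

end Literature.RingTheory.RegularLocalRing

end
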